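import Mathlib
import HarnessLib
import Summits.NavierStokesRegularity.NavierStokesRegularity.Theorems.TypeIQuarterGateScarEnvelopeTypeIForcedTsaiAlgMoments

/-!
# ARM B lane E-exact, Type-I-tail class — MOMENT LEMMAS II: polar factorisation on `ℝ³`, sphere moments
  from the Gaussian product moments, and the radial Beta integral by Gamma subordination (the analysis behind the
  EXACT ODD MOMENTS of LANEX-ALG v3, `…ForcedTsaiAlgCertG` / `…AlgMomentsOdd`)

* `integral_polar3` — `∫_{ℝ³} Θ(y/|y|)·R(|y|) dy = (∫_{S²} Θ dσ)·∫₀^∞ r² R(r) dr` for the measure `σ = volume.toSphere`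
  (Mathlib's `measurePreserving_homeomorphUnitSphereProd`; no integrability hypotheses: both sides use the same
  junk-value convention through `integral_prod_mul`);
* `sphMono` / `sphMono_eq` — the sphere moments `∫_{S²} θ^a dσ = 2Πᵢ Γ((aᵢ+1)/2)/Γ((|a|+3)/2)` (all `aᵢ` even,
  else `0`), identified by factorising the landed GAUSSIAN product moments — no spherical coordinates;
* `integral_radialBeta` — `∫₀^∞ rⁿ (1+r²/τ²)^{−h/2} dr = ½ τ^{n+1} Γ((n+1)/2) Γ((h−n−1)/2)/Γ(h/2)` (`h > n+1`) with
  integrability, by the subordination `(1+u)^{−h/2} = Γ(h/2)^{−1}∫₀^∞ s^{h/2−1}e^{−s(1+u)} ds` and Fubini on `(0,∞)²`;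
Nothing here bears on NS regularity. [folklore: polar coordinates, Beta and Gamma integrals]
-/

noncomputable section

set_option linter.dupNamespace false

namespace Summit.NavierStokesRegularity.NavierStokesRegularity.Cruxes.ScarEnvelopeTypeI.ForcedTsai

open MeasureTheory Set Metric Real Finset
open scoped RealInnerProductSpace

/-! ## Polar factorisation on `ℝ³` -/

/-- Integration against `volumeIoiPow 2` is the weighted set integral `∫_{(0,∞)} r²·R(r) dr`. [folklore] -/
theorem integral_volumeIoiPow_two (R : ℝ → ℝ) :
    ∫ r : Ioi (0 : ℝ), R r ∂(Measure.volumeIoiPow 2) = ∫ r in Ioi (0 : ℝ), r ^ 2 * R r := by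
  simp only [Measure.volumeIoiPow, ENNReal.ofReal]
  rw [integral_withDensity_eq_integral_smul (measurable_subtype_coe.pow_const _).real_toNNReal,
    integral_subtype_comap measurableSet_Ioi (fun a : ℝ => Real.toNNReal (a ^ 2) • R a)]
  refine setIntegral_congr_fun measurableSet_Ioi fun x hx => ?_
  rw [NNReal.smul_def, Real.coe_toNNReal _ (pow_nonneg hx.out.le _), smul_eq_mul]

/-- **Polar factorisation on `ℝ³`**: `∫ Θ(y/|y|)·R(|y|) dy = (∫_{S²} Θ dσ)·(∫₀^∞ r² R(r) dr)`, `σ = volume.toSphere`.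
[folklore; Mathlib `measurePreserving_homeomorphUnitSphereProd`] -/
theorem integral_polar3 (Θ : E3 → ℝ) (R : ℝ → ℝ) :
    ∫ y : E3, Θ (‖y‖⁻¹ • y) * R ‖y‖ =
      (∫ θ : sphere (0 : E3) 1, Θ θ ∂((volume : Measure E3).toSphere)) * ∫ r in Ioi (0 : ℝ), r ^ 2 * R r := by
  have h1 : ∫ y : E3, Θ (‖y‖⁻¹ • y) * R ‖y‖ =
      ∫ x : ({(0 : E3)}ᶜ : Set E3), Θ (‖(x : E3)‖⁻¹ • (x : E3)) * R ‖(x : E3)‖ ∂((volume : Measure E3).comap (↑)) := by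
    have := integral_subtype_comap (μ := (volume : Measure E3)) (measurableSet_singleton (0 : E3)).compl
      (fun y : E3 => Θ (‖y‖⁻¹ • y) * R ‖y‖)
    rw [restrict_compl_singleton] at this
    exact this.symm
  have h2 := (volume : Measure E3).measurePreserving_homeomorphUnitSphereProd.integral_comp
    (Homeomorph.measurableEmbedding _) (fun p : sphere (0 : E3) 1 × Ioi (0 : ℝ) => Θ p.1 * R p.2)
  have h3 : (fun x : ({(0 : E3)}ᶜ : Set E3) =>
      (fun p : sphere (0 : E3) 1 × Ioi (0 : ℝ) => Θ p.1 * R p.2) (homeomorphUnitSphereProd E3 x)) =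
      fun x : ({(0 : E3)}ᶜ : Set E3) => Θ (‖(x : E3)‖⁻¹ • (x : E3)) * R ‖(x : E3)‖ := by
    funext x
    simp only [homeomorphUnitSphereProd_apply_fst_coe, homeomorphUnitSphereProd_apply_snd_coe]
  have h4 : ∫ p : sphere (0 : E3) 1 × Ioi (0 : ℝ), Θ p.1 * R p.2
      ∂(((volume : Measure E3).toSphere).prod (Measure.volumeIoiPow (Module.finrank ℝ E3 - 1))) =
      (∫ θ : sphere (0 : E3) 1, Θ θ ∂((volume : Measure E3).toSphere)) *
        ∫ r : Ioi (0 : ℝ), R r ∂(Measure.volumeIoiPow (Module.finrank ℝ E3 - 1)) :=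
    integral_prod_mul (fun θ : sphere (0 : E3) 1 => Θ θ) (fun r : Ioi (0 : ℝ) => R r)
  rw [h1, ← h3, h2, h4, finrank_euclideanSpace_fin, show 3 - 1 = 2 from rfl, integral_volumeIoiPow_two]

/-- One coordinate of the direction: `(y/|y|)_j^e · |y|^e = y_j^e` (also at `y = 0`, where `y/|y| = 0`). -/
theorem dir_coord_pow_mul (y : E3) (j : Fin 3) (e : ℕ) : ((‖y‖⁻¹ • y) j) ^ e * ‖y‖ ^ e = (y j) ^ e := by
  rw [PiLp.smul_apply, smul_eq_mul, ← mul_pow, mul_right_comm]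
  rcases eq_or_ne y 0 with rfl | hy
  · simp
  · rw [inv_mul_cancel₀ (norm_ne_zero_iff.mpr hy), one_mul]

/-- The coordinate product splits into direction × radius: `Π_j (y/|y|)_j^{a_j} · |y|^{|a|} = Π_j y_j^{a_j}`. -/
theorem dir_prod_pow_mul (y : E3) (m : Mono) :
    (∏ j : Fin 3, ((‖y‖⁻¹ • y) j) ^ m.exp j) * ‖y‖ ^ (m.e1 + m.e2 + m.e3) = ∏ j : Fin 3, (y j) ^ m.exp j := by
  have hsum : m.e1 + m.e2 + m.e3 = ∑ j : Fin 3, m.exp j := by simp [Fin.sum_univ_three, Mono.exp]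
  rw [hsum, ← Finset.prod_pow_eq_pow_sum, ← Finset.prod_mul_distrib]
  exact Finset.prod_congr rfl fun j _ => dir_coord_pow_mul y j _

/-! ## Sphere moments from the Gaussian product moments -/

/-- The sphere moment `∫_{S²} θ₁^{a₁}θ₂^{a₂}θ₃^{a₃} dσ` (`σ = volume.toSphere`; coefficient of `m` unused). -/
def sphMono (m : Mono) : ℝ :=
  ∫ θ : sphere (0 : E3) 1, (∏ j : Fin 3, ((θ : E3) j) ^ m.exp j) ∂((volume : Measure E3).toSphere)

/-- The radial Gaussian integral `∫₀^∞ r^{n} e^{−r²} dr = ½ Γ((n+1)/2)`. [folklore] -/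
theorem integral_pow_mul_exp_neg_sq_Ioi (n : ℕ) :
    ∫ r in Ioi (0 : ℝ), r ^ n * Real.exp (-r ^ 2) = Real.Gamma (((n : ℝ) + 1) / 2) / 2 := by
  have h := integral_rpow_mul_exp_neg_mul_rpow two_pos (q := (n : ℝ)) (by have := n.cast_nonneg (α := ℝ); linarith)
    one_pos
  rw [Real.one_rpow, one_mul] at h
  rw [show Real.Gamma (((n : ℝ) + 1) / 2) / 2 = 1 / 2 * Real.Gamma (((n : ℝ) + 1) / 2) by ring, ← h]
  refine setIntegral_congr_fun measurableSet_Ioi fun r _ => ?_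
  rw [Real.rpow_natCast, Real.rpow_two, neg_mul, one_mul]

/-- **Polar form of a Gaussian monomial moment**: `∫ Π y_j^{a_j} e^{−|y|²} dy = sphMono · ½Γ((|a|+3)/2)`. -/
theorem integral_prod_pow_gauss_polar (m : Mono) :
    ∫ y : E3, (∏ j : Fin 3, (y j) ^ m.exp j) * gauss 1 y =
      sphMono m * (Real.Gamma ((((m.e1 + m.e2 + m.e3 : ℕ) : ℝ) + 3) / 2) / 2) := by
  have hfun : (fun y : E3 => (∏ j : Fin 3, (y j) ^ m.exp j) * gauss 1 y) =
      fun y => (∏ j : Fin 3, ((‖y‖⁻¹ • y) j) ^ m.exp j) * (‖y‖ ^ (m.e1 + m.e2 + m.e3) * Real.exp (-‖y‖ ^ 2)) := by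
    funext y; rw [← mul_assoc, dir_prod_pow_mul, gauss, neg_mul, one_mul]
  rw [hfun, integral_polar3 (fun θ : E3 => ∏ j : Fin 3, (θ j) ^ m.exp j)
    (fun r : ℝ => r ^ (m.e1 + m.e2 + m.e3) * Real.exp (-r ^ 2)), sphMono]
  congr 1
  have : (fun r : ℝ => r ^ 2 * (r ^ (m.e1 + m.e2 + m.e3) * Real.exp (-r ^ 2))) =
      fun r => r ^ (m.e1 + m.e2 + m.e3 + 2) * Real.exp (-r ^ 2) := by
    funext r; ring
  rw [this, integral_pow_mul_exp_neg_sq_Ioi]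
  congr 2; push_cast; ring


/-- The unit-coefficient `y`-monomial with the exponents of `m`. -/
def Mono.unit (m : Mono) : Mono := ⟨m.e1, m.e2, m.e3, 1⟩

/-- `Mono.unit` keeps the exponents. -/
@[simp] theorem Mono.exp_unit (m : Mono) (j : Fin 3) : m.unit.exp j = m.exp j := by
  fin_cases j <;> rfl

/-- **The sphere moments in closed form**: `∫_{S²} θ^a dσ = 2π·Πᵢ ghalf(aᵢ+1)/ghalf(|a|+3)`
(`= 2ΠᵢΓ((aᵢ+1)/2)/Γ((|a|+3)/2)`) if all `aᵢ` are even, and `0` otherwise — by factorising the Gaussian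
product moments through `integral_polar3`. [folklore] -/
theorem sphMono_eq (m : Mono) :
    sphMono m = if m.e1 % 2 = 1 ∨ m.e2 % 2 = 1 ∨ m.e3 % 2 = 1 then 0 else
      2 * π * ((ghalf (m.e1 + 1) : ℝ) * (ghalf (m.e2 + 1) : ℝ) * (ghalf (m.e3 + 1) : ℝ)) /
        (ghalf (m.e1 + m.e2 + m.e3 + 3) : ℝ) := by
  set A : ℕ := m.e1 + m.e2 + m.e3 with hA
  have hG : 0 < Real.Gamma ((((A : ℕ) : ℝ) + 3) / 2) := Real.Gamma_pos_of_pos (by positivity)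
  have hpolar := integral_prod_pow_gauss_polar m
  rw [← hA] at hpolar
  -- the same integral as a coordinate product
  obtain ⟨-, hv⟩ := integral_mono_gauss_real m.unit one_pos
  have hfun : (fun y : E3 => Mono.eval m.unit y * gauss 1 y) = fun y => (∏ j : Fin 3, (y j) ^ m.exp j) * gauss 1 y := by
    funext y; rw [Mono.eval_eq_prod, show m.unit.c = 1 from rfl, Rat.cast_one, one_mul]; simp only [Mono.exp_unit]
  rw [hfun, hpolar, Fin.prod_univ_three, show m.unit.c = 1 from rfl, Rat.cast_one, one_mul] at hv
  simp only [Mono.exp, Mono.unit] at hv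
  -- hv : sphMono m * (Γ/2) = (∫ t^e1 e^{-t²}) * (∫ t^e2 …) * (∫ t^e3 …)
  by_cases he : m.e1 % 2 = 1 ∨ m.e2 % 2 = 1 ∨ m.e3 % 2 = 1
  · rw [if_pos he]
    have hzero : sphMono m * (Real.Gamma ((((A : ℕ) : ℝ) + 3) / 2) / 2) = 0 := by
      rw [hv]
      rcases he with h1 | h2 | h3
      · obtain ⟨k, hk⟩ : ∃ k, m.e1 = 2 * k + 1 := ⟨m.e1 / 2, by omega⟩
        rw [hk, integral_pow_odd_mul_gauss1]; ring
      · obtain ⟨k, hk⟩ : ∃ k, m.e2 = 2 * k + 1 := ⟨m.e2 / 2, by omega⟩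
        rw [hk, integral_pow_odd_mul_gauss1]; ring
      · obtain ⟨k, hk⟩ : ∃ k, m.e3 = 2 * k + 1 := ⟨m.e3 / 2, by omega⟩
        rw [hk, integral_pow_odd_mul_gauss1]; ring
    rcases mul_eq_zero.mp hzero with h0 | h0
    · exact h0
    · exfalso; exact absurd h0 (by positivity)
  · rw [if_neg he]
    have h1 : m.e1 % 2 = 0 := by omega
    have h2 : m.e2 % 2 = 0 := by omega
    have h3 : m.e3 % 2 = 0 := by omega
    obtain ⟨k1, hk1⟩ : ∃ k, m.e1 = 2 * k := ⟨m.e1 / 2, by omega⟩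
    obtain ⟨k2, hk2⟩ : ∃ k, m.e2 = 2 * k := ⟨m.e2 / 2, by omega⟩
    obtain ⟨k3, hk3⟩ : ∃ k, m.e3 = 2 * k := ⟨m.e3 / 2, by omega⟩
    rw [hk1, hk2, hk3, integral_pow_even_gauss_ghalf k1 one_pos, integral_pow_even_gauss_ghalf k2 one_pos,
      integral_pow_even_gauss_ghalf k3 one_pos, Real.one_rpow, Real.one_rpow, Real.one_rpow] at hv
    have hGe : Real.Gamma ((((A : ℕ) : ℝ) + 3) / 2) = (ghalf (A + 3) : ℝ) * √π := by
      have := Gamma_half_eq_ghalf (A + 3) (by omega)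
      rw [if_pos (by omega)] at this
      rw [← this]; congr 1; push_cast; ring
    have hgh : (ghalf (A + 3) : ℝ) ≠ 0 := by
      rw [show A + 3 = 2 * ((A + 2) / 2) + 1 by omega, ghalf_odd_cast]
      exact Finset.prod_ne_zero_iff.mpr fun i _ => by positivity
    have hsp : √π ≠ 0 := (Real.sqrt_pos.2 Real.pi_pos).ne'
    have hsqrtpi : √π ^ 2 = π := Real.sq_sqrt Real.pi_pos.le
    rw [hGe] at hv
    rw [← hk1, ← hk2, ← hk3] at hv
    have hden : (ghalf (A + 3) : ℝ) * √π / 2 ≠ 0 := div_ne_zero (mul_ne_zero hgh hsp) two_ne_zero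
    -- solve the linear equation for sphMono m
    have key : sphMono m = (√π * (ghalf (m.e1 + 1) : ℝ) * 1 * (√π * (ghalf (m.e2 + 1) : ℝ) * 1) *
        (√π * (ghalf (m.e3 + 1) : ℝ) * 1)) / ((ghalf (A + 3) : ℝ) * √π / 2) := by
      rw [eq_div_iff hden, hv]
    calc sphMono m = _ := key
      _ = 2 * √π ^ 2 * ((ghalf (m.e1 + 1) : ℝ) * (ghalf (m.e2 + 1) : ℝ) * (ghalf (m.e3 + 1) : ℝ)) /
            (ghalf (A + 3) : ℝ) := by
          field_simp
      _ = _ := by rw [hsqrtpi]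


/-! ## The radial Beta integral `∫₀^∞ rⁿ (1+r²/τ²)^{−a} dr` by Gamma subordination -/

/-- The subordinated radial integrand on `(0,∞)²`: `rⁿ · Γ(a)⁻¹ s^{a−1} e^{−s} · e^{−(s/τ²) r²}`
(its `s`-integral is `rⁿ (1+r²/τ²)^{−a}`). -/
def subR (τ : ℝ) (n : ℕ) (a : ℝ) (p : ℝ × ℝ) : ℝ :=
  p.1 ^ n * ((Real.Gamma a)⁻¹ * (p.2 ^ (a - 1) * Real.exp (-p.2))) * Real.exp (-(p.2 / τ ^ 2) * p.1 ^ 2)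

/-- The product measure `volume|_{(0,∞)} × volume|_{(0,∞)}` on `ℝ × ℝ`. -/
def μI : Measure (ℝ × ℝ) := ((volume : Measure ℝ).restrict (Ioi 0)).prod ((volume : Measure ℝ).restrict (Ioi 0))

/-- **Subordination, pointwise**: `rⁿ (1+r²/τ²)^{−a} = ∫₀^∞ subR(r,s) ds` (`a > 0`). [folklore] -/
theorem pow_mul_rpow_neg_eq_integral_subR (τ : ℝ) (n : ℕ) {a : ℝ} (ha : 0 < a) (r : ℝ) :
    r ^ n * (1 + r ^ 2 / τ ^ 2) ^ (-a) = ∫ s in Ioi (0 : ℝ), subR τ n a (r, s) := by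
  have hk : 0 < 1 + r ^ 2 / τ ^ 2 := by positivity
  have hsub : (1 + r ^ 2 / τ ^ 2) ^ (-a) =
      (Real.Gamma a)⁻¹ * ∫ s in Ioi (0 : ℝ), s ^ (a - 1) * Real.exp (-((1 + r ^ 2 / τ ^ 2) * s)) := by
    rw [Real.integral_rpow_mul_exp_neg_mul_Ioi ha hk, one_div, Real.inv_rpow hk.le, Real.rpow_neg hk.le]
    have hG := (Real.Gamma_pos_of_pos ha).ne'
    field_simp
  rw [hsub, ← integral_const_mul, ← integral_const_mul]
  refine setIntegral_congr_fun measurableSet_Ioi fun s _ => ?_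
  rw [subR, show -((1 + r ^ 2 / τ ^ 2) * s) = -s + -(s / τ ^ 2) * r ^ 2 by ring, Real.exp_add]
  ring

/-- `subR` is continuous (for `a ≥ 1`). -/
theorem continuous_subR (τ : ℝ) (n : ℕ) {a : ℝ} (ha : 1 ≤ a) : Continuous (subR τ n a) := by
  unfold subR
  refine ((continuous_fst.pow n).mul (continuous_const.mul
    (((Real.continuous_rpow_const (by linarith)).comp continuous_snd).mul
      (Real.continuous_exp.comp continuous_snd.neg)))).mul ?_
  exact Real.continuous_exp.comp (((continuous_snd.div_const _).neg).mul (continuous_fst.pow 2))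

/-- The `r`-slice of `subR` at `s > 0`: integrable on `(0,∞)` with
`∫₀^∞ subR(r,s) dr = Γ(a)⁻¹ s^{a−1}e^{−s} · (s/τ²)^{−(n+1)/2} · ½ Γ((n+1)/2)` (`τ > 0`). [folklore] -/
theorem integral_subR_slice (τ : ℝ) (hτ : 0 < τ) (n : ℕ) (a : ℝ) {s : ℝ} (hs : 0 < s) :
    IntegrableOn (fun r : ℝ => subR τ n a (r, s)) (Ioi 0) ∧
      ∫ r in Ioi (0 : ℝ), subR τ n a (r, s) =
        (Real.Gamma a)⁻¹ * (s ^ (a - 1) * Real.exp (-s)) *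
          ((s / τ ^ 2) ^ (-((n : ℝ) + 1) / 2) * (1 / 2) * Real.Gamma (((n : ℝ) + 1) / 2)) := by
  have hb : 0 < s / τ ^ 2 := by positivity
  have hfun : (fun r : ℝ => subR τ n a (r, s)) =
      fun r => ((Real.Gamma a)⁻¹ * (s ^ (a - 1) * Real.exp (-s))) * (r ^ n * Real.exp (-(s / τ ^ 2) * r ^ 2)) := by
    funext r; simp only [subR]; ring
  rw [hfun]
  refine ⟨((integrable_pow_mul_gauss1 n hb).integrableOn).const_mul _, ?_⟩
  rw [integral_const_mul]
  congr 1
  have h := integral_rpow_mul_exp_neg_mul_rpow two_pos (q := (n : ℝ)) (by have := n.cast_nonneg (α := ℝ); linarith) hb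
  rw [← h]
  refine setIntegral_congr_fun measurableSet_Ioi fun r _ => ?_
  rw [Real.rpow_natCast, Real.rpow_two]

/-- `subR` is integrable on `(0,∞)²` when `a > (n+1)/2` (and `a ≥ 1`, `τ > 0`). [folklore] -/
theorem integrable_subR (τ : ℝ) (hτ : 0 < τ) (n : ℕ) {a : ℝ} (ha1 : 1 ≤ a) (hq : ((n : ℝ) + 1) / 2 < a) :
    Integrable (subR τ n a) μI := by
  have ha : 0 < a := by linarith
  set q : ℝ := ((n : ℝ) + 1) / 2 with hqdef
  have hcont := continuous_subR τ n ha1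
  rw [μI, integrable_prod_iff' hcont.aestronglyMeasurable]
  constructor
  · refine (ae_restrict_mem measurableSet_Ioi).mono fun s hs => ?_
    exact (integral_subR_slice τ hτ n a hs).1
  · -- s ↦ ∫_r ‖subR(r,s)‖ = C · e^{−s} s^{(a−q)−1} on (0,∞)
    set C : ℝ := (Real.Gamma a)⁻¹ * ((τ ^ 2) ^ q * ((1 / 2) * Real.Gamma q)) with hC
    have hG : IntegrableOn (fun s : ℝ => C * (Real.exp (-s) * s ^ ((a - q) - 1))) (Ioi 0) :=
      (Real.GammaIntegral_convergent (by linarith : 0 < a - q)).const_mul C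
    refine hG.congr_fun (fun s (hs : s ∈ Ioi (0 : ℝ)) => ?_) measurableSet_Ioi
    have hs' : (0 : ℝ) < s := hs
    have hnn : ∀ r ∈ Ioi (0 : ℝ), ‖subR τ n a (r, s)‖ = subR τ n a (r, s) := by
      intro r hr
      have hr' : (0 : ℝ) < r := hr
      rw [Real.norm_eq_abs, abs_of_nonneg]
      unfold subR
      have : 0 ≤ s ^ (a - 1) := Real.rpow_nonneg hs'.le _
      have : 0 < Real.Gamma a := Real.Gamma_pos_of_pos ha
      positivity
    beta_reduce
    rw [setIntegral_congr_fun measurableSet_Ioi hnn, (integral_subR_slice τ hτ n a hs').2, hC, ← hqdef,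
      show -((n : ℝ) + 1) / 2 = -q by rw [hqdef]; ring,
      Real.div_rpow hs'.le (by positivity) (-q), Real.rpow_neg hs'.le, Real.rpow_neg (by positivity),
      show s ^ (a - q - 1) = s ^ (a - 1) * s ^ (-q) by rw [← Real.rpow_add hs']; ring_nf]
    rw [Real.rpow_neg hs'.le]
    have hsq : s ^ q ≠ 0 := (Real.rpow_pos_of_pos hs' q).ne'
    have hτq : (τ ^ 2) ^ q ≠ 0 := (Real.rpow_pos_of_pos (by positivity) q).ne'
    field_simp

/-- **The radial Beta integral**: for `τ > 0`, `h > n + 1`: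
`r ↦ rⁿ (1+r²/τ²)^{−h/2}` is integrable on `(0,∞)` and
`∫₀^∞ rⁿ (1+r²/τ²)^{−h/2} dr = ½ τ^{n+1} Γ((n+1)/2) Γ((h−n−1)/2) / Γ(h/2)`. [folklore] -/
theorem integral_radialBeta (τ : ℝ) (hτ : 0 < τ) (n h : ℕ) (hh : n + 1 < h) :
    IntegrableOn (fun r : ℝ => r ^ n * (1 + r ^ 2 / τ ^ 2) ^ (-(h : ℝ) / 2)) (Ioi 0) ∧
      ∫ r in Ioi (0 : ℝ), r ^ n * (1 + r ^ 2 / τ ^ 2) ^ (-(h : ℝ) / 2) =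
        τ ^ (n + 1) / 2 * Real.Gamma (((n : ℝ) + 1) / 2) * Real.Gamma ((((h - (n + 1) : ℕ) : ℝ)) / 2) /
          Real.Gamma ((h : ℝ) / 2) := by
  set a : ℝ := (h : ℝ) / 2 with hadef
  set q : ℝ := ((n : ℝ) + 1) / 2 with hqdef
  have hh2 : (2 : ℝ) ≤ (h : ℝ) := by exact_mod_cast (show 2 ≤ h by omega)
  have hnh : ((n : ℝ) + 1) < (h : ℝ) := by exact_mod_cast hh
  have ha1 : 1 ≤ a := by rw [hadef]; linarith
  have ha : 0 < a := by linarith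
  have hqa : q < a := by rw [hqdef, hadef]; linarith
  have hF := integrable_subR τ hτ n ha1 (by rw [hadef]; linarith)
  have hpt : ∀ r : ℝ, r ^ n * (1 + r ^ 2 / τ ^ 2) ^ (-(h : ℝ) / 2) = ∫ s in Ioi (0 : ℝ), subR τ n a (r, s) := by
    intro r
    rw [show (-(h : ℝ) / 2) = -a by rw [hadef]; ring]
    exact pow_mul_rpow_neg_eq_integral_subR τ n ha r
  have hfun : (fun r : ℝ => r ^ n * (1 + r ^ 2 / τ ^ 2) ^ (-(h : ℝ) / 2)) =
      fun r => ∫ s in Ioi (0 : ℝ), subR τ n a (r, s) := funext hpt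
  rw [hfun]
  constructor
  · exact hF.integral_prod_left
  · have hswap := MeasureTheory.integral_integral_swap (f := fun (r : ℝ) (s : ℝ) => subR τ n a (r, s))
      (μ := (volume : Measure ℝ).restrict (Ioi 0)) (ν := (volume : Measure ℝ).restrict (Ioi 0))
      (by simpa only [μI, Function.uncurry_def, Prod.mk.eta] using hF)
    rw [hswap]
    have hinner : ∀ s ∈ Ioi (0 : ℝ), ∫ r in Ioi (0 : ℝ), subR τ n a (r, s) =
        ((Real.Gamma a)⁻¹ * ((τ ^ 2) ^ q * ((1 / 2) * Real.Gamma q))) * (Real.exp (-s) * s ^ ((a - q) - 1)) := by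
      intro s hs
      have hs' : (0 : ℝ) < s := hs
      rw [(integral_subR_slice τ hτ n a hs').2, ← hqdef, show -((n : ℝ) + 1) / 2 = -q by rw [hqdef]; ring,
        Real.div_rpow hs'.le (by positivity) (-q), Real.rpow_neg hs'.le, Real.rpow_neg (by positivity),
        show s ^ (a - q - 1) = s ^ (a - 1) * s ^ (-q) by rw [← Real.rpow_add hs']; ring_nf, Real.rpow_neg hs'.le]
      have hsq : s ^ q ≠ 0 := (Real.rpow_pos_of_pos hs' q).ne'
      have hτq : (τ ^ 2) ^ q ≠ 0 := (Real.rpow_pos_of_pos (by positivity) q).ne'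
      field_simp
    rw [setIntegral_congr_fun measurableSet_Ioi hinner, integral_const_mul, ← Real.Gamma_eq_integral (by linarith)]
    have hτ2q : (τ ^ 2) ^ q = τ ^ (n + 1) := by
      rw [← Real.rpow_natCast τ 2, ← Real.rpow_mul hτ.le, hqdef, ← Real.rpow_natCast]
      congr 1; push_cast; ring
    have haq : a - q = (((h - (n + 1) : ℕ) : ℝ)) / 2 := by
      rw [hadef, hqdef, Nat.cast_sub hh.le]; push_cast; ring
    rw [hτ2q, haq]
    have hGa : Real.Gamma a ≠ 0 := (Real.Gamma_pos_of_pos ha).ne'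
    field_simp


end Summit.NavierStokesRegularity.NavierStokesRegularity.Cruxes.ScarEnvelopeTypeI.ForcedTsai

end
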